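import Mathlib
import HarnessLib
import Summits.HubbardSuperconductivity.HubbardSuperconductivity.Theorems.KLProgrammeKLRegimeSplitEdgeFactsBubblePin

/-!
# Route `KLProgramme` — edge facts for the pair masses ACROSS TRANSFERS, II: the transfer modulus of a pair mass of EVEN symbols is a SECOND DIFFERENCE
# (the deep-transfer half of the shortfall row (D2); the class-edge effect made quantitative)

Cell gate-hubbard-kl, seat hubbard-kl-k3c1-p1 (g20; child-1 lineage).  Sequel to `…SplitEdgeFactsBubblePin` (row 15: the conj form
`klBubbleMass β μ K a b Q p = (βL²)⁻¹·Σ_ν Re(g^a_ν(p)·conj g^b_ν(Q − p))`, `g^e_ν(p) = e(ν,p)·ĝ_K(ν,p)`; the propagator and the CT weight are even in the momentum).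
Context (pen g26 (R394)(I); E1 docket (3)/(5′)): after rows 13/14 (`…SWaveCascadePinnedDomination`, `…SWaveCascadeTransferDifferences`) the (s2) «SUP-VS-PIN» input of the
norm-side brick (T2) is reduced to the SHORTFALL row (D2) `Σ_{j<n}(W_j(0) − W_j(q)) ≤ Θ` and the PINNED FLOOR (D3).  THIS FILE is the algebra behind (D2)'s deep scales:

* §1 on any finite abelian group, for `f, h` EVEN: the convolution `C(q) = Σ_p f(p)·h(q − p)` is even (`conv_even_of_even`) and its TRANSFER MODULUS IS A SECOND DIFFERENCE,
  **`C(q) − C(0) = ½·Σ_p f(p)·(h(q − p) − 2h(−p) + h(−q − p))`** (`conv_sub_conv_zero_eq`), so `‖C(q) − C(0)‖ ≤ ½·Σ_p ‖f(p)‖·‖h(p + q) − 2h(p) + h(p − q)‖`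
  (`norm_conv_sub_conv_zero_le`) — first order cancels by evenness;
* §2 for symbols `a, b` even in frequency and momentum (`β ≥ 0`):
  **`|Σ_p klBubbleMass a b Q p − Σ_p klBubbleMass a b 0 p| ≤ ½(βL²)⁻¹·Σ_ν Σ_p ‖g^a_ν(p)‖·‖g^b_ν(p + Q) − 2g^b_ν(p) + g^b_ν(p − Q)‖`** (`abs_sum_klBubbleMass_sub_pin_le`), and for
  the transfer mass of an even member `φ` at scale `n`,
  `|Σ_p klTransferWeight β μ K n φ Q p − Σ_p klTransferWeight β μ K n φ 0 p| ≤ ½(βL²)⁻¹·Σ_ν Σ_p (‖g^w_ν(p)‖·‖δ²_Q g^φ_ν(p)‖ + ‖g^φ_ν(p)‖·‖δ²_Q g^w_ν(p)‖)`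
  (`abs_sum_klTransferWeight_sub_pin_le`; `w = w^K_{Λ_n}`, `δ²_Q g(p) = g(p + Q) − 2g(p) + g(p − Q)`).

Reading for (D2): a transfer `q` in class at step `n+1` is DEEP for the scales `j ≤ n − 3` (`|q|·4^j ≪ 1`), where the symmetric second difference of `p ↦ φ_j(ν,p)·ĝ_K(ν,p)` at
step `q` is `O((|q|/Λ_j)²)` of its size — so `|W_j(q) − W_j(0)| = O(b·(|q|·4^j)²)`, geometric in `j`; the ≤ 3 edge scales are paid by the free envelope.  The second-difference
rows themselves (jets of `e_K`, the cutoff's profile) are E1's.  Everything is proved; no definitions; nothing asserts any slot, stub, K3 or superconductivity. [folklore]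
-/

noncomputable section

namespace Summit.HubbardSuperconductivity.HubbardSuperconductivity.Theorems.KLRegimeSplit

set_option linter.dupNamespace false -- summit = problem name (single-conjunct summit), D-0017

open Real Finset Literature.MathematicalPhysics.QuantumLattice Literature.Probability.LatticeModels
open Literature.MathematicalPhysics.QuantumLattice.FermiRG
open Summit.HubbardSuperconductivity.HubbardSuperconductivity.Theorems.KLProgrammeLegKernels
open Summit.HubbardSuperconductivity.HubbardSuperconductivity.Theorems.TwoPointAssembly
open ComplexConjugate

/-! ## §1 Even convolutions on a finite abelian group: the transfer modulus is a second difference -/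

section Conv

variable {G : Type*} [Fintype G] [AddCommGroup G] {f h : G → ℂ}

/-- The convolution of two even functions is even: `Σ_p f(p)·h(−q − p) = Σ_p f(p)·h(q − p)`. [folklore] -/
theorem conv_even_of_even (hf : ∀ p, f (-p) = f p) (hh : ∀ p, h (-p) = h p) (q : G) :
    ∑ p, f p * h (-q - p) = ∑ p, f p * h (q - p) :=
  Fintype.sum_equiv (Equiv.neg G) (fun p => f p * h (-q - p)) (fun p => f p * h (q - p)) fun p => by
    simp only [Equiv.neg_apply]
    rw [hf, show q - -p = -(-q - p) by abel, hh]

/-- **The transfer modulus of an even convolution is a second difference**: for `f, h` even,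
`Σ_p f(p)·h(q − p) − Σ_p f(p)·h(0 − p) = ½·Σ_p f(p)·(h(q − p) − 2h(−p) + h(−q − p))`. [folklore] -/
theorem conv_sub_conv_zero_eq (hf : ∀ p, f (-p) = f p) (hh : ∀ p, h (-p) = h p) (q : G) :
    ∑ p, f p * h (q - p) - ∑ p, f p * h (0 - p) = (1 / 2 : ℂ) * ∑ p, f p * (h (q - p) - 2 * h (-p) + h (-q - p)) := by
  have hev := conv_even_of_even hf hh q
  have hsplit : ∑ p, f p * (h (q - p) - 2 * h (-p) + h (-q - p)) =
      ∑ p, f p * h (q - p) + ∑ p, f p * h (-q - p) - 2 * ∑ p, f p * h (-p) := by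
    have hp : ∀ p, f p * (h (q - p) - 2 * h (-p) + h (-q - p)) = f p * h (q - p) + f p * h (-q - p) - 2 * (f p * h (-p)) :=
      fun p => by ring
    simp only [hp, sum_sub_distrib, sum_add_distrib, ← mul_sum]
  rw [hsplit, hev]
  simp only [zero_sub]
  ring

/-- … hence `‖Σ_p f(p)·h(q − p) − Σ_p f(p)·h(0 − p)‖ ≤ ½·Σ_p ‖f(p)‖·‖h(p + q) − 2h(p) + h(p − q)‖` (the symmetric second difference at `p` with step `q`, by evenness of `h`).
[folklore] -/
theorem norm_conv_sub_conv_zero_le (hf : ∀ p, f (-p) = f p) (hh : ∀ p, h (-p) = h p) (q : G) :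
    ‖∑ p, f p * h (q - p) - ∑ p, f p * h (0 - p)‖ ≤ 1 / 2 * ∑ p, ‖f p‖ * ‖h (p + q) - 2 * h p + h (p - q)‖ := by
  rw [conv_sub_conv_zero_eq hf hh q, norm_mul]
  have h2 : ‖(1 / 2 : ℂ)‖ = 1 / 2 := by
    rw [one_div, norm_inv, Complex.norm_ofNat, one_div]
  rw [h2]
  refine mul_le_mul_of_nonneg_left ((norm_sum_le _ _).trans (le_of_eq (sum_congr rfl fun p _ => ?_))) (by norm_num)
  rw [norm_mul]
  congr 2
  rw [hh p, show q - p = -(p - q) by abel, hh, show -q - p = -(p + q) by abel, hh]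
  ring

end Conv

/-! ## §2 The pair mass and the transfer mass across transfers -/

section Model

variable {L M : ℕ} [NeZero L] (β μ : ℝ) (K : TrigPolyC4v)

/-- **The transfer modulus of the pair mass of even symbols** (`β ≥ 0`; `a, b` even in frequency and momentum; `g^e_ν(p) = e(ν,p)·ĝ_K(ν,p)`):
`|Σ_p klBubbleMass a b Q p − Σ_p klBubbleMass a b 0 p| ≤ ½(βL²)⁻¹·Σ_ν Σ_p ‖g^a_ν(p)‖·‖g^b_ν(p + Q) − 2g^b_ν(p) + g^b_ν(p − Q)‖`. [folklore] -/
theorem abs_sum_klBubbleMass_sub_pin_le (hβ : 0 ≤ β) {a b : FreqMomentum L M → ℝ}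
    (ha' : ∀ k : FreqMomentum L M, a (k.1, -k.2) = a k)
    (hb : ∀ k : FreqMomentum L M, b (k.1.rev, k.2) = b k) (hb' : ∀ k : FreqMomentum L M, b (k.1, -k.2) = b k) (Qm : TorusSite 2 L) :
    |∑ p, klBubbleMass L M β μ K a b Qm p - ∑ p, klBubbleMass L M β μ K a b 0 p| ≤
      1 / 2 * (β * (L : ℝ) ^ 2)⁻¹ * ∑ ν : MatsubaraIdx M, ∑ p : TorusSite 2 L,
        ‖(a (ν, p) : ℂ) * propCT L M β μ K (ν, p)‖ *
          ‖(b (ν, p + Qm) : ℂ) * propCT L M β μ K (ν, p + Qm) - 2 * ((b (ν, p) : ℂ) * propCT L M β μ K (ν, p)) +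
            (b (ν, p - Qm) : ℂ) * propCT L M β μ K (ν, p - Qm)‖ := by
  set c : ℝ := (β * (L : ℝ) ^ 2)⁻¹ with hc
  have hc0 : 0 ≤ c := by positivity
  set ga : MatsubaraIdx M → TorusSite 2 L → ℂ := fun ν p => (a (ν, p) : ℂ) * propCT L M β μ K (ν, p) with hga
  set gb : MatsubaraIdx M → TorusSite 2 L → ℂ := fun ν p => (b (ν, p) : ℂ) * propCT L M β μ K (ν, p) with hgb
  -- evenness in the momentum
  have hga_ev : ∀ ν p, ga ν (-p) = ga ν p := fun ν p => by
    simp only [hga]; rw [propCT_neg_momentum β μ K ν p, show a (ν, -p) = a (ν, p) from ha' (ν, p)]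
  have hgb_ev : ∀ ν p, gb ν (-p) = gb ν p := fun ν p => by
    simp only [hgb]; rw [propCT_neg_momentum β μ K ν p, show b (ν, -p) = b (ν, p) from hb' (ν, p)]
  have hh_ev : ∀ ν p, conj (gb ν (-p)) = conj (gb ν p) := fun ν p => by rw [hgb_ev]
  -- the mass as `c · Re` of a double sum of convolutions
  have hS : ∀ Q : TorusSite 2 L, ∑ p, klBubbleMass L M β μ K a b Q p = c * (∑ ν, ∑ p, ga ν p * conj (gb ν (Q - p))).re := by
    intro Q
    simp only [Complex.re_sum, Finset.mul_sum]
    rw [sum_comm]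
    refine sum_congr rfl fun p _ => ?_
    rw [klBubbleMass_eq_re_sum_conj β μ K hb Q p, Finset.mul_sum]
  rw [hS Qm, hS 0, ← mul_sub, ← Complex.sub_re, ← sum_sub_distrib, abs_mul, abs_of_nonneg hc0,
    show 1 / 2 * c * _ = c * (1 / 2 * ∑ ν : MatsubaraIdx M, ∑ p : TorusSite 2 L, ‖ga ν p‖ *
      ‖gb ν (p + Qm) - 2 * gb ν p + gb ν (p - Qm)‖) by ring]
  refine mul_le_mul_of_nonneg_left ?_ hc0
  refine (Complex.abs_re_le_norm _).trans ((norm_sum_le _ _).trans ?_)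
  rw [mul_sum]
  refine sum_le_sum fun ν _ => ?_
  have h := norm_conv_sub_conv_zero_le (f := ga ν) (h := fun p => conj (gb ν p)) (hga_ev ν) (hh_ev ν) Qm
  refine h.trans (le_of_eq ?_)
  refine congrArg (1 / 2 * ·) (sum_congr rfl fun p _ => ?_)
  congr 1
  rw [← Complex.norm_conj (gb ν (p + Qm) - 2 * gb ν p + gb ν (p - Qm))]
  simp only [map_sub, map_add, map_mul, map_ofNat]

/-- **The transfer modulus of the transfer mass of an even member** (`β ≥ 0`, `φ` even in frequency and momentum; `w = w^K_{Λ_n}`,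
`δ²_Q g(p) = g(p + Q) − 2g(p) + g(p − Q)`):
`|Σ_p klTransferWeight β μ K n φ Q p − Σ_p klTransferWeight β μ K n φ 0 p| ≤ ½(βL²)⁻¹·Σ_ν Σ_p (‖g^w_ν(p)‖·‖δ²_Q g^φ_ν(p)‖ + ‖g^φ_ν(p)‖·‖δ²_Q g^w_ν(p)‖)`. [folklore] -/
theorem abs_sum_klTransferWeight_sub_pin_le (hβ : 0 ≤ β) (n : ℕ) {φ : FreqMomentum L M → ℝ}
    (hφ : ∀ k : FreqMomentum L M, φ (k.1.rev, k.2) = φ k) (hφ' : ∀ k : FreqMomentum L M, φ (k.1, -k.2) = φ k) (Qm : TorusSite 2 L) :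
    |∑ p, klTransferWeight L M β μ K n φ Qm p - ∑ p, klTransferWeight L M β μ K n φ 0 p| ≤
      1 / 2 * (β * (L : ℝ) ^ 2)⁻¹ * ∑ ν : MatsubaraIdx M, ∑ p : TorusSite 2 L,
        (‖(hubbardCutoffWeightCT L M β μ K (klScale klE0 n) (ν, p) : ℂ) * propCT L M β μ K (ν, p)‖ *
            ‖(φ (ν, p + Qm) : ℂ) * propCT L M β μ K (ν, p + Qm) - 2 * ((φ (ν, p) : ℂ) * propCT L M β μ K (ν, p)) +
              (φ (ν, p - Qm) : ℂ) * propCT L M β μ K (ν, p - Qm)‖ +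
          ‖(φ (ν, p) : ℂ) * propCT L M β μ K (ν, p)‖ *
            ‖(hubbardCutoffWeightCT L M β μ K (klScale klE0 n) (ν, p + Qm) : ℂ) * propCT L M β μ K (ν, p + Qm) -
                2 * ((hubbardCutoffWeightCT L M β μ K (klScale klE0 n) (ν, p) : ℂ) * propCT L M β μ K (ν, p)) +
              (hubbardCutoffWeightCT L M β μ K (klScale klE0 n) (ν, p - Qm) : ℂ) * propCT L M β μ K (ν, p - Qm)‖) := by
  have hw : ∀ k : FreqMomentum L M, hubbardCutoffWeightCT L M β μ K (klScale klE0 n) (k.1.rev, k.2) = hubbardCutoffWeightCT L M β μ K (klScale klE0 n) k :=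
    fun k => hubbardCutoffWeightCT_revFreq L M β μ K _ k
  have hw' : ∀ k : FreqMomentum L M, hubbardCutoffWeightCT L M β μ K (klScale klE0 n) (k.1, -k.2) = hubbardCutoffWeightCT L M β μ K (klScale klE0 n) k :=
    fun k => hubbardCutoffWeightCT_neg_momentum β μ K _ k.1 k.2
  have heq : ∀ Q : TorusSite 2 L, ∑ p, klTransferWeight L M β μ K n φ Q p =
      -(∑ p, klBubbleMass L M β μ K (hubbardCutoffWeightCT L M β μ K (klScale klE0 n)) φ Q p +
        ∑ p, klBubbleMass L M β μ K φ (hubbardCutoffWeightCT L M β μ K (klScale klE0 n)) Q p) := by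
    intro Q
    rw [← sum_add_distrib, ← sum_neg_distrib]
    exact sum_congr rfl fun p _ => klTransferWeight_eq_neg_bubbleMass β μ K n φ Q p
  have h1 := abs_sum_klBubbleMass_sub_pin_le β μ K hβ hw' hφ hφ' Qm
  have h2 := abs_sum_klBubbleMass_sub_pin_le β μ K hβ hφ' hw hw' Qm
  rw [heq Qm, heq 0, show ∀ x y : ℝ, -x - -y = -(x - y) from fun x y => by ring, abs_neg,
    show ∀ x₁ x₂ y₁ y₂ : ℝ, x₁ + x₂ - (y₁ + y₂) = (x₁ - y₁) + (x₂ - y₂) from fun _ _ _ _ => by ring]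
  refine (abs_add_le _ _).trans ?_
  have hsum : 1 / 2 * (β * (L : ℝ) ^ 2)⁻¹ * ∑ ν : MatsubaraIdx M, ∑ p : TorusSite 2 L,
        (‖(hubbardCutoffWeightCT L M β μ K (klScale klE0 n) (ν, p) : ℂ) * propCT L M β μ K (ν, p)‖ *
            ‖(φ (ν, p + Qm) : ℂ) * propCT L M β μ K (ν, p + Qm) - 2 * ((φ (ν, p) : ℂ) * propCT L M β μ K (ν, p)) +
              (φ (ν, p - Qm) : ℂ) * propCT L M β μ K (ν, p - Qm)‖ +
          ‖(φ (ν, p) : ℂ) * propCT L M β μ K (ν, p)‖ *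
            ‖(hubbardCutoffWeightCT L M β μ K (klScale klE0 n) (ν, p + Qm) : ℂ) * propCT L M β μ K (ν, p + Qm) -
                2 * ((hubbardCutoffWeightCT L M β μ K (klScale klE0 n) (ν, p) : ℂ) * propCT L M β μ K (ν, p)) +
              (hubbardCutoffWeightCT L M β μ K (klScale klE0 n) (ν, p - Qm) : ℂ) * propCT L M β μ K (ν, p - Qm)‖) =
      1 / 2 * (β * (L : ℝ) ^ 2)⁻¹ * ∑ ν : MatsubaraIdx M, ∑ p : TorusSite 2 L,
        ‖(hubbardCutoffWeightCT L M β μ K (klScale klE0 n) (ν, p) : ℂ) * propCT L M β μ K (ν, p)‖ *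
            ‖(φ (ν, p + Qm) : ℂ) * propCT L M β μ K (ν, p + Qm) - 2 * ((φ (ν, p) : ℂ) * propCT L M β μ K (ν, p)) +
              (φ (ν, p - Qm) : ℂ) * propCT L M β μ K (ν, p - Qm)‖ +
      1 / 2 * (β * (L : ℝ) ^ 2)⁻¹ * ∑ ν : MatsubaraIdx M, ∑ p : TorusSite 2 L,
          ‖(φ (ν, p) : ℂ) * propCT L M β μ K (ν, p)‖ *
            ‖(hubbardCutoffWeightCT L M β μ K (klScale klE0 n) (ν, p + Qm) : ℂ) * propCT L M β μ K (ν, p + Qm) -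
                2 * ((hubbardCutoffWeightCT L M β μ K (klScale klE0 n) (ν, p) : ℂ) * propCT L M β μ K (ν, p)) +
              (hubbardCutoffWeightCT L M β μ K (klScale klE0 n) (ν, p - Qm) : ℂ) * propCT L M β μ K (ν, p - Qm)‖ := by
    rw [← mul_add, ← sum_add_distrib]
    congr 1
    exact sum_congr rfl fun ν _ => sum_add_distrib
  rw [hsum]
  exact add_le_add h1 h2

end Model

end Summit.HubbardSuperconductivity.HubbardSuperconductivity.Theorems.KLRegimeSplit

end
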